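import Summits.QuantumFields.YangMills.Theorems.BalabanLadderNTBoundaryLawLargeDepth
import HarnessLib

/-!
# Crux `NT` (stmt-QuantumFields-19353), stub `stub_cfp : CFP`: the boundary law pins the torus means to its reference value

Helper file (`--supports stmt-QuantumFields-19353`) of the fleet lead prover of crux `NT` (unit `ym-spine-19353-p1`);
companion of `BalabanLadderNTBoundaryLawLargeDepth` / `…Symmetry` on the engine side of the registered stub
`stub_cfp : CFP` (skeleton v2 «conditional-package», b5b471720c374849).

The femto boundary law `FBL G r a` (`Theorems/LangevinControlUVOSLegsFromFemtoAndGapDefs.lean` :136) compares the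
cube-kernel means of the action density with a free reference value `p β`.  By the torus DLR equation (tree
`torusE_eq_torusE_kerE`: the torus mean is the torus average of the cube-kernel means) the reference value is NOT
free: on EVERY odd torus `(ℤ/(2L+1))⁴` large enough to hold a femto cube of radius `R` (`L ≥ R + 1`,
`(2R+1) · a β ≤ ℓ₁`), the torus mean of the action density is within `C₁ / (R+1)⁴` of `p β`
(`fbl_pins_torusMean`); hence the plaquette-density mean at weak coupling depends on the torus size only at order
`(a β / ℓ₁)⁴` (`torusMean_sub_torusMean_le_of_fbl`), and `p β` may be REPLACED by any such torus mean at the cost of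
doubling the constant.  The same for the plane-resolved law `FBL6` and the single-plane fields
(`fbl6_pins_torusMean`).

* `abs_torusE_sub_le_of_kernel` — pointwise transfer: if every cube-kernel mean of a bounded continuous cylinder
  observable in the window is within `h` of `p`, so is its torus mean (`L ≥ R + 1`);
* `fbl_pins_torusMean`, `torusMean_sub_torusMean_le_of_fbl`, `fbl6_pins_torusMean`.
-/

set_option autoImplicit false

noncomputable section

open MeasureTheory Filter Topology
open Literature.MathematicalPhysics.QuantumFieldTheory Literature.MathematicalPhysics.QuantumLattice
open Literature.Probability.LatticeModels
open Summit.QuantumFields.YangMills.Cruxes.OSLegsFromFemtoAndGap.DlrCollarTransfer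
open Summit.QuantumFields.YangMills.Cruxes.OSLegsFromFemtoAndGap.DlrCollarTransfer.StubLower

namespace Summit.QuantumFields.YangMills.Cruxes.NT.BoundaryLaw

variable (G : Type) [Group G] [TopologicalSpace G] [IsTopologicalGroup G] [CompactSpace G]
  [MeasurableSpace G] [BorelSpace G] (r : LatticeRep G)

/-- **Kernel-to-torus transfer of a one-point bound.**  Let `F` be a bounded continuous cylinder observable
supported in the window `x + [−R, R]⁴` and `L ≥ R + 1`.  If for EVERY exterior `η` the mean of `F` under the kernel
of the cube of radius `R` around `x` is within `h` of `p`, then the torus mean of `F` on `(ℤ/(2L+1))⁴` is within `h`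
of `p` (torus DLR: `torusE F = torusE (η ↦ kerE η F)`, and the torus measure is a probability measure). [folklore] -/
theorem abs_torusE_sub_le_of_kernel (β : ℝ) (x : Fin 4 → ℤ) (R L : ℕ) (hRL : R + 1 ≤ L)
    {F : LGConfig 4 G → ℝ} (hF : Continuous F) {C : ℝ} (hC : ∀ U, |F U| ≤ C)
    {S₀ : Finset (Literature.MathematicalPhysics.QuantumLattice.ZdEdge 4)} (hFS : IsCylinder F S₀)
    (hS₀ : ∀ e ∈ S₀, ∀ j, x j - R ≤ e.1 j ∧ e.1 j ≤ x j + R) {p h : ℝ}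
    (hker : ∀ η, |kerE G r β (fun j => x j - R) (2 * R + 1) η F - p| ≤ h) :
    |torusE G r β L F - p| ≤ h := by
  haveI := r.secondCountableTopology
  haveI := isProbabilityMeasure_wilsonMeasure (d := 4) (L := 2 * L + 1) r.ρ r.continuous β
  rw [torusE_eq_torusE_kerE G r β x R L hRL hF hC hFS hS₀]
  unfold torusE
  set f : GaugeConfig 4 (2 * L + 1) G → ℝ :=
    fun U => kerE G r β (fun j => x j - R) (2 * R + 1) (torusLift (2 * L + 1) U) F with hf
  have hfc : Continuous f := by
    rw [hf]; unfold kerE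
    exact (continuous_integral_ymSpecification r.ρ r.continuous β _ hF hC).comp (continuous_torusLift _)
  have hfb : ∀ U, |f U| ≤ C := fun U => abs_kerE_le G r β _ _ _ hC
  have hfi : Integrable f (wilsonMeasure (d := 4) (L := 2 * L + 1) r.ρ β) :=
    Integrable.of_bound (C := C) hfc.measurable.aestronglyMeasurable
      (Eventually.of_forall fun U => by rw [Real.norm_eq_abs]; exact hfb U)
  have hsub : ∫ U, f U ∂(wilsonMeasure (d := 4) (L := 2 * L + 1) r.ρ β) - p =
      ∫ U, (f U - p) ∂(wilsonMeasure (d := 4) (L := 2 * L + 1) r.ρ β) := by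
    rw [integral_sub hfi (integrable_const p), integral_const, smul_eq_mul]
    simp
  change |∫ U, f U ∂(wilsonMeasure (d := 4) (L := 2 * L + 1) r.ρ β) - p| ≤ h
  rw [hsub]
  have key := norm_integral_le_of_norm_le_const (μ := wilsonMeasure (d := 4) (L := 2 * L + 1) r.ρ β)
    (f := fun U => f U - p) (C := h) (Eventually.of_forall fun U => by rw [Real.norm_eq_abs]; exact hker _)
  simpa [Real.norm_eq_abs] using key

/-- The centre `x` of the cube of radius `R` around `x` has depth at least `R + 1` (in fact exactly). [folklore] -/
theorem succ_le_depth_centre (x : Fin 4 → ℤ) (R : ℕ) : R + 1 ≤ depth (fun j => x j - R) (2 * R + 1) x := by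
  have h := le_depth_cube x x R (t := 0) (fun j => by simp)
  rw [sub_zero] at h
  exact_mod_cast h

/-- **The boundary law pins the torus means of the action density to its reference value.**  `FBL G r a` yields
witnesses `C₁, β₁, ℓ₁, p` such that, besides the boundary law itself, on every odd torus `(ℤ/(2L+1))⁴` holding a femto
cube of radius `R ≥ 1` (`(2R+1) · a β ≤ ℓ₁`, `L ≥ R + 1`, `β ≥ β₁`) the torus mean of the action density at any site
is within `C₁ / (R+1)⁴` of `p β`. [folklore] -/
theorem fbl_pins_torusMean (a : ℝ → ℝ) (h : FBL G r a) :
    ∃ (C₁ β₁ ℓ₁ : ℝ) (p : ℝ → ℝ), 0 < ℓ₁ ∧ 0 ≤ C₁ ∧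
      (∀ β : ℝ, β₁ ≤ β → ∀ (c : Fin 4 → ℤ) (b : ℕ), (b : ℝ) * a β ≤ ℓ₁ → ∀ (η : LGConfig 4 G) (x : Fin 4 → ℤ),
        2 ≤ depth c b x → |kerE G r β c b η (dens G r x) - p β| ≤ C₁ / (depth c b x : ℝ) ^ 4) ∧
      (∀ β : ℝ, β₁ ≤ β → ∀ (R L : ℕ) (x : Fin 4 → ℤ), 1 ≤ R → ((2 * R + 1 : ℕ) : ℝ) * a β ≤ ℓ₁ → R + 1 ≤ L →
        |torusE G r β L (dens G r x) - p β| ≤ C₁ / ((R : ℝ) + 1) ^ 4) := by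
  obtain ⟨C₁, β₁, ℓ₁, p, hℓ₁, hC₁, H⟩ := h
  refine ⟨C₁, β₁, ℓ₁, p, hℓ₁, hC₁, H, ?_⟩
  intro β hβ R L x hR hRa hRL
  obtain ⟨C, -, hC⟩ := exists_abs_dens_le G r
  have hxx : ∀ j, |x j - x j| + 1 ≤ (R : ℤ) := fun j => by simp; exact_mod_cast hR
  have hd := succ_le_depth_centre x R
  have hd2 : 2 ≤ depth (fun j => x j - R) (2 * R + 1) x := le_trans (by omega) hd
  refine abs_torusE_sub_le_of_kernel G r β x R L hRL (continuous_dens r x) (hC x) (isCylinder_dens G r x)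
    (dens_supp_window G r x x R hxx) fun η => ?_
  calc |kerE G r β (fun j => x j - R) (2 * R + 1) η (dens G r x) - p β|
      ≤ C₁ / (depth (fun j => x j - R) (2 * R + 1) x : ℝ) ^ 4 := H β hβ _ _ hRa η x hd2
    _ ≤ C₁ / ((R : ℝ) + 1) ^ 4 := by
        gcongr
        exact_mod_cast hd

/-- **Finite-size insensitivity of the density mean under the boundary law.**  Under `FBL G r a`, the torus means
of the action density on two odd tori both holding a femto cube of radius `R ≥ 1` differ by at most
`2 C₁ / (R+1)⁴` — with `R ≍ ℓ₁ / (2 a β)` this is `O((a β / ℓ₁)⁴)`. [folklore] -/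
theorem torusMean_sub_torusMean_le_of_fbl (a : ℝ → ℝ) (h : FBL G r a) :
    ∃ (C₁ β₁ ℓ₁ : ℝ), 0 < ℓ₁ ∧ 0 ≤ C₁ ∧ ∀ β : ℝ, β₁ ≤ β → ∀ (R L L' : ℕ) (x : Fin 4 → ℤ), 1 ≤ R →
      ((2 * R + 1 : ℕ) : ℝ) * a β ≤ ℓ₁ → R + 1 ≤ L → R + 1 ≤ L' →
        |torusE G r β L (dens G r x) - torusE G r β L' (dens G r x)| ≤ 2 * C₁ / ((R : ℝ) + 1) ^ 4 := by
  obtain ⟨C₁, β₁, ℓ₁, p, hℓ₁, hC₁, -, H⟩ := fbl_pins_torusMean G r a h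
  refine ⟨C₁, β₁, ℓ₁, hℓ₁, hC₁, fun β hβ R L L' x hR hRa hL hL' => ?_⟩
  have h1 := H β hβ R L x hR hRa hL
  have h2 := H β hβ R L' x hR hRa hL'
  calc |torusE G r β L (dens G r x) - torusE G r β L' (dens G r x)|
      = |(torusE G r β L (dens G r x) - p β) - (torusE G r β L' (dens G r x) - p β)| := by ring_nf
    _ ≤ |torusE G r β L (dens G r x) - p β| + |torusE G r β L' (dens G r x) - p β| := abs_sub _ _
    _ ≤ C₁ / ((R : ℝ) + 1) ^ 4 + C₁ / ((R : ℝ) + 1) ^ 4 := add_le_add h1 h2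
    _ = 2 * C₁ / ((R : ℝ) + 1) ^ 4 := by ring

/-- **The plane-resolved boundary law pins the torus means of the single-plane fields.**  `FBL6 G r a` yields
witnesses `C₁, β₁, ℓ₁, p` such that, besides the law itself, on every odd torus holding a femto cube of radius
`R ≥ 1` (`(2R+1) · a β ≤ ℓ₁`, `L ≥ R + 1`, `β ≥ β₁`) the torus mean of the `(i, j)`-plaquette field (`i < j`) at any
site is within `C₁ / (R+1)⁴` of `p (i, j) β`. [folklore] -/
theorem fbl6_pins_torusMean (a : ℝ → ℝ) (h : FBL6 G r a) :
    ∃ (C₁ β₁ ℓ₁ : ℝ) (p : Fin 4 × Fin 4 → ℝ → ℝ), 0 < ℓ₁ ∧ 0 ≤ C₁ ∧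
      (∀ β : ℝ, β₁ ≤ β → ∀ (c : Fin 4 → ℤ) (b : ℕ), (b : ℝ) * a β ≤ ℓ₁ →
        ∀ (η : LGConfig 4 G) (q : Fin 4 × Fin 4) (x : Fin 4 → ℤ), q.1 < q.2 → 2 ≤ depth c b x →
          |kerE G r β c b η (plane G r q x) - p q β| ≤ C₁ / (depth c b x : ℝ) ^ 4) ∧
      (∀ β : ℝ, β₁ ≤ β → ∀ (R L : ℕ) (q : Fin 4 × Fin 4) (x : Fin 4 → ℤ), q.1 < q.2 → 1 ≤ R →
        ((2 * R + 1 : ℕ) : ℝ) * a β ≤ ℓ₁ → R + 1 ≤ L →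
          |torusE G r β L (plane G r q x) - p q β| ≤ C₁ / ((R : ℝ) + 1) ^ 4) := by
  obtain ⟨C₁, β₁, ℓ₁, p, hℓ₁, hC₁, H⟩ := h
  refine ⟨C₁, β₁, ℓ₁, p, hℓ₁, hC₁, H, ?_⟩
  intro β hβ R L q x hq hR hRa hRL
  obtain ⟨C, hC⟩ := exists_abs_plane_le (G := G) r
  have hd := succ_le_depth_centre x R
  have hd2 : 2 ≤ depth (fun j => x j - R) (2 * R + 1) x := le_trans (by omega) hd
  have hwin : ∀ e ∈ (originPlaquetteSupport q.1 q.2).image (fun e => (e.1 - -x, e.2)), ∀ j,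
      x j - R ≤ e.1 j ∧ e.1 j ≤ x j + R := fun e he j => by
    obtain ⟨h0, h1⟩ := near_of_mem_supp_plane he j
    have hR' : (1 : ℤ) ≤ R := by exact_mod_cast hR
    constructor <;> omega
  refine abs_torusE_sub_le_of_kernel G r β x R L hRL (continuous_plane r q x) (hC q x) (isCylinder_plane r q x)
    hwin fun η => ?_
  calc |kerE G r β (fun j => x j - R) (2 * R + 1) η (plane G r q x) - p q β|
      ≤ C₁ / (depth (fun j => x j - R) (2 * R + 1) x : ℝ) ^ 4 := H β hβ _ _ hRa η q x hq hd2
    _ ≤ C₁ / ((R : ℝ) + 1) ^ 4 := by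
        gcongr
        exact_mod_cast hd

end Summit.QuantumFields.YangMills.Cruxes.NT.BoundaryLaw

end
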